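import Literature.Analysis.FluidPDE.TaoLocalisation
import Literature.Analysis.FluidPDE.NSLerayHopf
import Literature.Claims.NS.ClayVariants
import Literature.Analysis.PDE.HarmonicSmoothLiouville
import Literature.Analysis.FluidPDE.PeriodicGalileanNonuniqueness
import HarnessLib

/-!
# Claim skeleton (D-0090 NS-CLAIMS, C113): Baev 2022 — classical NS solutions «with p = 0» in
# Lagrangian coordinates, in a bounded domain and in all of `ℝⁿ`

Typed skeleton of А. В. Баев (A. V. Baev), «О решении уравнения Навье-Стокса для вязкой несжимаемой
жидкости в n-мерной ограниченной области и всем пространстве ℝⁿ», *Проблемы динамического управления*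
(МГУ, ВМК) вып. 71 (2022), с. 4–23 (bib `Baev2022ru`, the Russian ORIGINAL = text of record; English
translation *Comput. Math. Model.* 33 (2022) 255–272 = bib `Baev2022`, not used). Print pages `p.N`
below (PDF page = print page − 3); verbatim Russian and the literal translation used are in
`run/shared/lean/pub/ns-claims/sources/Baev2022/TRANSLATION.md` (ns-claims-lit-1 g4). UNREFEREED CLAIM
under adjudication — NOTHING in this file asserts a step of the paper: the paper's statements are
`def … : Prop`; the only `theorem`s are the kernel composition of the paper's OWN implications
(`claim_of_steps`), the trivial relation between the two printed readings of the data class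
(`claimedTheorem11_of_claimedTheorem`) and the Clay link (`clay_of_claimed`). Verdict vocabulary is the
refuter's / referee's.

## The claimed statement, as printed (Theorem 3 p.15 and its `n = 3`, all-orders case Corollary 4 p.16)
«Теорема 3. Задача (24), (25) ∀v₀ ∈ ℰ^{2l,α}_m и ∀T > t₀ имеет единственное классическое решение
v, x ∈ ℰ^{2l,α}_{T,m}, p = 0. При этом ∀t ≥ t₀ справедливы оценка ‖v‖_{C(ℝⁿ)} ≤ ‖v₀‖_{C(ℝⁿ)} и, при
m > n, тождество ‖v(t)‖²_{L₂(ℝⁿ)} = ‖v₀‖²_{L₂(ℝⁿ)} − 2ε∫_{t₀}^t ‖∇v(τ)‖²_{L₂(ℝⁿ)} dτ.» / «Следствие 4.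
Задача (24), (25) ∀v₀ ∈ ℰ и ∀T > t₀ имеет единственное классическое решение v, x ∈ ℰ_T, p = 0. При
этом ∀t ≥ t₀ справедливы оценки ‖v‖_{C(ℝ³)} ≤ ‖v₀‖_{C(ℝ³)} и ‖v‖²_{L₂(ℝ³)} ≤ ‖v₀‖²_{L₂(ℝ³)}.»
[Theorem 3. Problem (24), (25) has, for every `v₀ ∈ ℰ^{2l,α}_m` and every `T > t₀`, a unique classical
solution `v, x ∈ ℰ^{2l,α}_{T,m}`, **`p = 0`**; moreover `‖v‖_C ≤ ‖v₀‖_C` for all `t ≥ t₀` and, for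
`m > n`, the energy identity. Corollary 4 (`n = 3`, the class `ℰ` = decay (25) of ALL orders): the
same with `‖v(t)‖²_{L₂} ≤ ‖v₀‖²_{L₂}`.] Here (24) (p.14) is the unforced Navier–Stokes Cauchy problem
in `ℝⁿ`, `2 ≤ n ≤ 3`, written in LAGRANGIAN variables `a`: `v_t = εΔv − ∇p`, `v|_∞ = 0`,
`v(a,t₀) = v₀(a)`; `x_t = v`, `x(a,t₀) = a` (with (1) `div v = 0` and the «invariant» operators
`Δ = Δ(x)`, `∇`, `div` of p.6/p.10 — the Eulerian ones pulled back by the flow map; p.7 (2) is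
«уравнение Навье–Стокса в переменных Лагранжа»), and (25) is the decay of `v₀`, `v` with all their
derivatives faster than every power of `|a|` (class `ℰ`, `ℰ_T`). The paper's standing assumption
(p.10 last line of Cor. 2's proof: «Далее в работе везде предполагаем выполнение условий (10),(11)»;
p.14: «Пусть для v₀ выполнено условие (11)») adds to the data (10) `div v₀ = 0`, `p₀ = const` and
(11) `(v₀,∇)v₀ = 0`.
TYPED over the tree's Eulerian Clay vocabulary on `ℝ³` with `t₀ = 0` (time translation),
`ε = ν > 0` the viscosity: `ClaimedTheorem` = Corollary 4 as its sentence reads (every smooth,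
divergence-free, rapidly decreasing `v₀` — exactly Clay's data (4) — has a smooth solution of (1)–(3)
on `ℝ³ × [0,∞)` WITH PRESSURE IDENTICALLY `0`, obeying the maximum principle and
`‖v(t)‖_{L²} ≤ ‖v₀‖_{L²}`); `ClaimedTheorem11` = the same under the standing hypothesis (11). The
Lagrangian/Eulerian identification is the paper's own (p.10, proof of Cor. 2: «производная по
направлению и дивергенция инвариантны относительно выбора системы координат»: `(v,∇)v`, `div`,
`Δ` are the same objects in either description), so an Eulerian typing loses nothing the paper
asserts. The uniqueness clause (within `ℰ_T`) is not typed — it is not where the claim bears on Clay.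

## Delta to Clay (A) (`ClayVariants` §2 matrix)
Δ1 `ℝ³` (= (A); the paper: `ℝⁿ`, `2 ≤ n ≤ 3`). Δ2 EQUATIONS: NS (1)–(2) p.7, = (A) — but the
conclusion adds `p ≡ 0`, i.e. the solution produced solves `v_t + (v·∇)v = εΔv`, `div v = 0`.
Δ3 `f ≡ 0` in (24) ✓. Δ4 DATA: `ℰ` = smooth with all derivatives rapidly decreasing = Clay (4) ✓ for
`ClaimedTheorem`; under the standing assumption (11) `(v₀,∇)v₀ = 0` (`ClaimedTheorem11`) the data
class is NARROWER (a rapidly decreasing field with `(v₀,∇)v₀ = 0` is constant along its own straight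
integral lines, hence `0` — refuter's remark to check). Δ5 classical, `‖v(t)‖₂ ≤ ‖v₀‖₂` ⇒ (7) ✓.
Δ6 conclusion STRONGER than (A) (`p ≡ 0`, maximum principle). Δ7 every `ε > 0` ✓.
`clay_of_claimed : ClaimedTheorem → ClayVariants.clayR3.Regularity` is PROVED below (no wrong-problem
axis for the Corollary-4 reading); for the (11)-reading the Clay data do not enter (Δ4).

## Ordered Step index (print order of the argument pp.7–16)
* Step 1 = `Eq12` ((12) p.8: «так как операторы div и ∂/∂t коммутируют при |g| = 1, то из (1),(2)
  имеем Δ(p + u) = 0» — for every solution, `Δp = 0` in the unforced case), typed for classical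
  solutions on `ℝ³ × [0,T]`.
* Step 2 = `NeumannLiouville` (p.15 first paragraph of the proof of Thm 3 = Cor. 1 (15) p.9 in `ℝⁿ`:
  «Δp = 0, ∇p|_∞ = 0 ⟹ p = const … положим p = 0») — the harmonic-function step, typed as printed.
* Step 3 = `Cor2` (Следствие 2 p.10: every solution has `(v,∇)v = 0` for all `t` — the paper's
  licence for treating (11) as no restriction), typed for classical solutions on `ℝ³ × [0,T]`.
* Step 4 = `PressureFreeExistence` (Thm 3's proof proper pp.15–16, «дословно повторяет
  доказательство теоремы 1» pp.11–13: iteration (22), Hölder estimates [9],[16], restart (23)): global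
  smooth solvability of the PRESSURE-FREE system `v_t + (v·∇)v = εΔv`, `v(0) = v₀` with the maximum
  principle, and the `L²` bound granted incompressibility (energy computation p.13), for every `v₀ ∈ ℰ`.
* Step 5 = `DivFreePersists` (implicit between (24) and Thm 3, pp.10/14: «учтено условие
  несжимаемости в виде |g| = 1» — the solution of the pressure-free system keeps `div v = 0`).
COMPOSITION: proved as `claim_of_steps : Step 4 → Step 5 → ClaimedTheorem` (Steps 1–3 are the
paper's justification that the pressure may be dropped and that (11) costs nothing; they feed Step 4's
legitimacy, not the kernel composition — MAP-SCHEMA §1b: refuted intermediate + load-bearing locator).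

## References
* А. В. Баев, Проблемы динамического управления 71 (2022) 4–23 (`Baev2022ru`): (1)–(3) p.7, (4)–(11)
  pp.7–8, (12)–(15) Lemma 1 / Remark 1 / Cor. 1 pp.8–9, Cor. 2 p.10, (16)–(20) pp.10–11, Thm 1 p.11,
  Cor. 3 / Thm 2 p.14, (24)–(25) p.14, Thm 3 p.15, Cor. 4 p.16, Conclusion pp.21–22.
* Cell files: `claims/Baev2022/CARD.md` (typist-1 PREDICTION 22:27:57Z), `sources/Baev2022/`
  (lit-1 g4 LOCATORS.md, TRANSLATION.md).

WHAT THIS IS NOT: not a claim about NS regularity or blow-up; not a claim about any author beyond the typed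
locator.
-/

noncomputable section

open MeasureTheory Set Function Filter Topology
open scoped InnerProductSpace ContDiff ENNReal
open Laplacian

namespace Literature.Claims.NS.Baev2022

open Literature.Analysis.FluidPDE

/-! ## Carriers and the printed classes -/

/-- Physical space `ℝ³` (the paper: `ℝⁿ`, `2 ≤ n ≤ 3`; Cor. 4 p.16 is the case `n = 3`). [folklore] -/
abbrev E3 : Type := EuclideanSpace ℝ (Fin 3)

/-- The data class of Corollary 4 with (10): `v₀ ∈ ℰ` — all derivatives decay faster than every power
of `|a|` ((25.1) p.14 for all `m, l`; = Clay (4) `HasRapidSpatialDecay`) — smooth, and `div v₀ = 0`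
((1) p.7, (10) p.7). [cite: Baev2022ru, (25.1) p.14; Следствие 4 p.16; (10) p.7] -/
def IsDatum (v₀ : E3 → E3) : Prop :=
  ContDiff ℝ ∞ v₀ ∧ NSWave0.IsDivFree v₀ ∧ HasRapidSpatialDecay v₀

/-- Condition (11) p.7, the paper's standing assumption on the data (p.10: «Далее в работе везде
предполагаем выполнение условий (10),(11)»; p.14: «Пусть для v₀ выполнено условие (11)»):
`(v₀,∇)v₀ = 0`. [cite: Baev2022ru, (11) p.7; p.10; p.14] -/
def Cond11 (v₀ : E3 → E3) : Prop :=
  ∀ x : E3, convect v₀ v₀ x = 0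

/-- «Классическое решение, p = 0» of (24) on `ℝ³ × [t₀,∞)` (every `T > t₀`), `t₀ = 0`, Eulerian
reading: `v` smooth on `ℝ³ × [0,∞)` solving (1)–(3) with viscosity `ε`, force `0`, datum `v₀` and the
pressure IDENTICALLY ZERO. [cite: Baev2022ru, Теорема 3 p.15; (24) p.14] -/
def SolvesWithZeroPressure (ε : ℝ) (v₀ : E3 → E3) (v : ℝ → E3 → E3) : Prop :=
  IsSmoothOnHalfSpace v ∧ IsNavierStokesSolution ε 0 v₀ v (fun _ _ => 0)

/-- The maximum principle «‖v‖_{C(ℝⁿ)} ≤ ‖v₀‖_{C(ℝⁿ)} ∀t ≥ t₀», typed without suprema: every bound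
of `|v₀|` bounds `|v(t)|`. [cite: Baev2022ru, Теорема 3 p.15] -/
def MaxPrinciple (v₀ : E3 → E3) (v : ℝ → E3 → E3) : Prop :=
  ∀ M : ℝ, (∀ x, ‖v₀ x‖ ≤ M) → ∀ t : ℝ, 0 ≤ t → ∀ x, ‖v t x‖ ≤ M

/-- The energy bound of Corollary 4, «‖v‖²_{L₂(ℝ³)} ≤ ‖v₀‖²_{L₂(ℝ³)}» for all `t ≥ t₀` (lower Lebesgue
integrals, no junk). [cite: Baev2022ru, Следствие 4 p.16] -/
def EnergyBound (v₀ : E3 → E3) (v : ℝ → E3 → E3) : Prop :=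
  ∀ t : ℝ, 0 ≤ t → ∫⁻ x, ‖v t x‖ₑ ^ 2 ≤ ∫⁻ x, ‖v₀ x‖ₑ ^ 2

/-! ## The claimed theorem (two printed readings of the data class) -/

/-- **CLAIMED THEOREM** (Corollary 4 p.16 = Theorem 3 p.15 for `n = 3` in the all-orders class `ℰ`,
existence clause with its estimates, as the sentence reads: «∀v₀ ∈ ℰ»): for every `ε > 0` and every
smooth, divergence-free, rapidly decreasing `v₀` there is a classical solution of the unforced
Navier–Stokes system on `ℝ³ × [0,∞)` with datum `v₀` and PRESSURE `p ≡ 0`, obeying the maximum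
principle and `‖v(t)‖₂ ≤ ‖v₀‖₂`. [claim: Baev2022ru, status: under-review] [cite: Baev2022ru, Следствие 4 p.16; Теорема 3 p.15] -/
def ClaimedTheorem : Prop :=
  ∀ ε : ℝ, 0 < ε → ∀ v₀ : E3 → E3, IsDatum v₀ →
    ∃ v : ℝ → E3 → E3, SolvesWithZeroPressure ε v₀ v ∧ MaxPrinciple v₀ v ∧ EnergyBound v₀ v

/-- **CLAIMED THEOREM, (11)-reading**: the same under the paper's standing assumption (11)
`(v₀,∇)v₀ = 0` on the datum (p.10, p.14). [claim: Baev2022ru, status: under-review] [cite: Baev2022ru, Теорема 3 p.15 with (11) p.7, p.14] -/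
def ClaimedTheorem11 : Prop :=
  ∀ ε : ℝ, 0 < ε → ∀ v₀ : E3 → E3, IsDatum v₀ → Cond11 v₀ →
    ∃ v : ℝ → E3 → E3, SolvesWithZeroPressure ε v₀ v ∧ MaxPrinciple v₀ v ∧ EnergyBound v₀ v

/-! ## The Steps of the printed argument -/

/-- **Step 1 — equation (12)** (p.8): «Так как операторы div = (1/√|g|) Σᵢ ∂/∂aⁱ √|g| и ∂/∂t
коммутируют при |g| = 1, то из (1),(2) имеем Δ(p + u) = 0» [since div and ∂/∂t commute when
`|g| = 1`, from (1),(2) we have `Δ(p + u) = 0`]; unforced (`u = 0`, `j = 0`): the pressure of every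
solution is harmonic at every time. Typed for classical solutions of the unforced system on
`ℝ³ × [0,T]` (the setting of §2.4; `Δ` the Eulerian = «invariant» Laplacian, p.6/p.10).
[claim: Baev2022ru, status: under-review] [cite: Baev2022ru, (12) p.8; used p.15 «Δp = 0»] -/
def Eq12 : Prop :=
  ∀ ε : ℝ, 0 < ε → ∀ T : ℝ, 0 < T → ∀ (v : ℝ → E3 → E3) (p : ℝ → E3 → ℝ),
    IsClassicalNSSolutionOn (Icc 0 T) ε 0 v p → ∀ t ∈ Icc 0 T, ∀ x : E3, Δ (p t) x = 0

/-- **Step 2 — the Neumann/Liouville step** (p.15, first paragraph of the proof of Thm 3: «для задачи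
Неймана имеем Δp = 0, ∇p|_∞ = 0 ⟹ p = const … Не нарушая общности, положим p = 0»; = Cor. 1 (15)
p.9 in `ℝⁿ`): a `C²` harmonic function on `ℝ³` whose gradient tends to `0` at infinity is constant.
(True.) [claim: Baev2022ru, status: under-review] [cite: Baev2022ru, proof of Теорема 3 ¶1 p.15; Следствие 1 (15) p.9] -/
def NeumannLiouville : Prop :=
  ∀ q : E3 → ℝ, ContDiff ℝ 2 q → (∀ x, Δ q x = 0) →
    Tendsto (fun x => gradient q x) (cocompact E3) (𝓝 0) → ∃ c : ℝ, ∀ x, q x = c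

/-- **Step 3 — Corollary 2** (p.10): «Пусть решение задачи … существует. Тогда ∀t ≥ 0 выполняется
равенство (v,∇)v = 0» [for every solution, `(v,∇)v = 0` for all `t`] — proved in print from (12)
(`div (v,∇)v = 0`) and «rot (v,∇)v = −[∇,[v, rot v]] = (∇,v) rot v − (∇, rot v) v = 0»; it is what
makes (11) «no restriction». Typed for classical solutions of the unforced system on `ℝ³ × [0,T]`.
[claim: Baev2022ru, status: under-review] [cite: Baev2022ru, Следствие 2 p.10] -/
def Cor2 : Prop :=
  ∀ ε : ℝ, 0 < ε → ∀ T : ℝ, 0 < T → ∀ (v : ℝ → E3 → E3) (p : ℝ → E3 → ℝ),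
    IsClassicalNSSolutionOn (Icc 0 T) ε 0 v p → ∀ t ∈ Icc 0 T, ∀ x : E3, convect (v t) (v t) x = 0

/-- The pressure-free («p = 0») evolution the paper actually solves — (24) without `∇p`, Eulerian
form `∂ₜv + (v·∇)v = εΔv` on `ℝ³ × [0,∞)` with `v(0) = v₀` (p.15: «слагаемое ∇p в уравнении (24)
исчезает»), `v` smooth on the closed half-space. [cite: Baev2022ru, (24) p.14; proof of Теорема 3 p.15] -/
def SolvesPressureFree (ε : ℝ) (v₀ : E3 → E3) (v : ℝ → E3 → E3) : Prop :=
  IsSmoothOnHalfSpace v ∧ v 0 = v₀ ∧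
    ∀ t : ℝ, 0 ≤ t → ∀ x : E3,
      derivWithin (fun s => v s x) (Ici 0) t + fderiv ℝ (v t) x (v t x) = ε • (Δ (v t)) x

/-- **Step 4 — existence for the pressure-free system** (proof of Thm 3 pp.15–16 after «p = 0»,
«дословно повторяет доказательство теоремы 1» pp.11–13: local step by the iteration (22) with the
Hölder estimates of [9],[16], restart (23), maximum principle, energy computation p.13): for every
`ε > 0` and `v₀ ∈ ℰ` (smooth, divergence-free, rapidly decreasing) the pressure-free problem has a
global smooth solution with `‖v(t)‖_C ≤ ‖v₀‖_C`, and with `‖v(t)‖₂ ≤ ‖v₀‖₂` granted incompressibility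
of the flow (the printed energy computation p.13, «(1/2) d/dt ∫|v|² da = ε∫(v,Δv) da = −ε∫|∇v|² da»,
integrates by parts in the volume-preserving Lagrangian variables, `|g| = 1`).
[claim: Baev2022ru, status: under-review] [cite: Baev2022ru, proof of Теорема 3 pp.15–16; Теорема 1 pp.11–13] -/
def PressureFreeExistence : Prop :=
  ∀ ε : ℝ, 0 < ε → ∀ v₀ : E3 → E3, IsDatum v₀ →
    ∃ v : ℝ → E3 → E3, SolvesPressureFree ε v₀ v ∧ MaxPrinciple v₀ v ∧
      ((∀ t : ℝ, 0 ≤ t → NSWave0.IsDivFree (v t)) → EnergyBound v₀ v)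

/-- **Step 5 — incompressibility persists for the pressure-free flow** (implicit between (24) and
Theorem 3: (1) `div v = 0` is among the «основные уравнения (справедливы в D̄)» p.7 and is «учтено … в
виде |g| = 1» inside `Δ(x)` p.10; the theorem's «classical solution of (24),(25)» is a solution of
(1),(2)): every smooth solution of `∂ₜv + (v·∇)v = εΔv` issued from a datum in `ℰ` with `div v₀ = 0`
stays divergence free. [claim: Baev2022ru, status: under-review] [cite: Baev2022ru, (1) p.7; p.10 «учтено условие несжимаемости в виде |g| = 1»; Теорема 3 p.15] -/
def DivFreePersists : Prop :=
  ∀ ε : ℝ, 0 < ε → ∀ (v₀ : E3 → E3) (v : ℝ → E3 → E3), IsDatum v₀ → SolvesPressureFree ε v₀ v →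
    ∀ t : ℝ, 0 ≤ t → NSWave0.IsDivFree (v t)

/-! ## Kernel compositions -/

/-- The (11)-reading follows from the Corollary-4 reading (fewer data). [cite: Baev2022ru, Теорема 3 p.15] -/
theorem claimedTheorem11_of_claimedTheorem (h : ClaimedTheorem) : ClaimedTheorem11 :=
  fun ε hε v₀ hv₀ _ => h ε hε v₀ hv₀

/-- **COMPOSITION**: a global smooth solution of the pressure-free system (Step 4) that stays
divergence free (Step 5) IS a classical Navier–Stokes solution with `p ≡ 0` — the momentum equation
(1) with `∇0 = 0` and `f = 0`. [cite: Baev2022ru, proof of Теорема 3 p.15] -/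
theorem claim_of_steps (h₄ : PressureFreeExistence) (h₅ : DivFreePersists) : ClaimedTheorem := by
  intro ε hε v₀ hv₀
  obtain ⟨v, hv, hmax, hen⟩ := h₄ ε hε v₀ hv₀
  have hdiv : ∀ t : ℝ, 0 ≤ t → NSWave0.IsDivFree (v t) := fun t ht => h₅ ε hε v₀ v hv₀ hv t ht
  refine ⟨v, ⟨hv.1, ?_⟩, hmax, hen hdiv⟩
  refine ⟨fun t ht x => ?_, hdiv, hv.2.1⟩
  have hg : gradient (fun _ : E3 => (0 : ℝ)) x = 0 := by
    simp [gradient]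
  rw [hv.2.2 t ht x, hg]
  simp

/-! ## The Clay link (cell TYPING-HYGIENE 10(a)) -/

/-- A rapidly decreasing field is square integrable (tree: Tao 2013 §1, `H^∞` from Schwartz decay).
[cite: Baev2022ru, Следствие 4 p.16] -/
theorem lintegral_sq_lt_top_of_isDatum {v₀ : E3 → E3} (h : IsDatum v₀) :
    ∫⁻ x, ‖v₀ x‖ₑ ^ 2 < ⊤ := by
  have h0 := h.2.2.lintegral_enorm_iteratedFDeriv_sq_lt_top (μ := volume) 0
  have heq : ∀ x : E3, ‖iteratedFDeriv ℝ 0 v₀ x‖ₑ = ‖v₀ x‖ₑ := fun x => by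
    rw [← ofReal_norm, ← ofReal_norm, norm_iteratedFDeriv_zero]
  simpa [heq] using h0

/-- **CLAY LINK, PROVED**: the claimed theorem (Corollary-4 reading) implies Clay (A)
(`ClayVariants.clayR3.Regularity`): the zero-pressure solution is a Clay-sense solution, smooth
(`p ≡ 0` is smooth), with energy bounded by `‖v₀‖₂² < ∞`. [cite: Baev2022ru, Следствие 4 p.16] -/
theorem clay_of_claimed (h : ClaimedTheorem) : ClayVariants.clayR3.Regularity := by
  intro ν hν u₀ hu₀ hdiv hdec
  obtain ⟨v, ⟨hsm, hns⟩, _, hen⟩ := h ν hν u₀ ⟨hu₀, hdiv, hdec⟩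
  refine ⟨v, fun _ _ => 0, hsm, contDiffOn_const, hns, ?_⟩
  exact ⟨∫⁻ x, ‖u₀ x‖ₑ ^ 2, lintegral_sq_lt_top_of_isDatum ⟨hu₀, hdiv, hdec⟩, fun t ht => hen t ht⟩

/-! ## Kernel certificate for Step 2 — the Neumann/Liouville step (append-only, D-0026 debt)

«Δp = 0, ∇p|_∞ = 0 ⟹ p = const» (proof of Теорема 3 ¶1 p.15; = Следствие 1 (15) p.9): a `C²` harmonic
function on `ℝ³` whose gradient tends to `0` at infinity is constant — TRUE and classical (Liouville's
theorem for the bounded harmonic map `∇q`, Gilbarg–Trudinger Thm 2.10), discharged from the tree lemma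
`Literature.Analysis.PDE.isConst_of_harmonic_of_tendsto_gradient` (`HarmonicSmoothLiouville`). It is the
premise `Δp = 0` (Step 1, (12) p.8) that the refuter lane tests, not this inference; nothing in the
verdict / locator / class / statements changes. FIRST KERNEL PROOF (Summits side, not importable from
`Literature/`): `Summit.NavierStokesRegularity.NavierStokesRegularity.Theorems.Baev2022.step2_neumannLiouville_holds`
(`Theorems/SoloSalvageBaev2022.lean`, seat ns-claims-salvage-p1 g2) — this in-file copy exists only so that
the Literature-side fact `NeumannLiouville` carries its `_holds` (D-0026 census). -/

/-- **Step 2 (the Neumann/Liouville step, p.15 ¶1 / Cor. 1 (15) p.9) is a THEOREM**: a `C²` harmonic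
function on `ℝ³` whose gradient tends to `0` at infinity is constant. Literature-side twin of the
Summits-side `Summit.NavierStokesRegularity.NavierStokesRegularity.Theorems.Baev2022.step2_neumannLiouville_holds`.
[cite: Baev2022ru, proof of Теорема 3 ¶1 p.15; Следствие 1 (15) p.9] [cite: GilbargTrudinger2001, Thm 2.10] -/
theorem neumannLiouville_holds : NeumannLiouville := by
  intro q hq hΔ hg
  exact ⟨q 0, fun x => Literature.Analysis.PDE.isConst_of_harmonic_of_tendsto_gradient hq hΔ hg x 0⟩

/-! ## Kernel certificate for the (11)-reading `ClaimedTheorem11` (append-only, D-0026 debt)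

Under the paper's standing assumption (11) `(v₀,∇)v₀ = 0` (p.7, p.10, p.14) the data class of Теорема 3 /
Следствие 4 is the ZERO datum alone: a rapidly decreasing `C¹` field with `(U·∇)U ≡ 0` is constant along
its own straight integral lines, hence `0` (the module docstring's «refuter's remark to check», Δ4). So
the (11)-reading `ClaimedTheorem11` is TRUE — witnessed by the rest state `v ≡ 0`, `p ≡ 0` only; it says
nothing about any non-zero datum and nothing about Clay (A). A positive theorem, not a kill: the row's
adjudicated locator (#84, `Eq12`) / class / statements are untouched. FIRST KERNEL PROOF (Summits side,
not importable from `Literature/`):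
`Summit.NavierStokesRegularity.NavierStokesRegularity.Theorems.Baev2022.claimedTheorem11_holds`
(`Theorems/SoloRefuteBaev2022Cond11.lean`, refuter-2 lineage) — this in-file copy (same proof, helpers
private) exists only so that the Literature-side fact carries its `_holds` (D-0026 census). -/

section Cond11Certificate

open Metric

/-- **A decaying `C¹` field with straight streamlines vanishes.** If `U` is `C¹`,
`(1 + ‖y‖) ‖U y‖ ≤ C` for all `y`, and `DU(x)[U x] = 0` for all `x` (`(U·∇)U ≡ 0`), then `U = 0`:
along the line `t ↦ x₀ + tU(x₀)` the defect `w(t) = U(x₀ + tU(x₀)) − U(x₀)` solves `w' = −DU w`,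
`w(0) = 0`, so `w ≡ 0` (Grönwall on every `[0,b]`); the particle keeps the speed `|U(x₀)| ≠ 0` while
`|x₀ + tU(x₀)| → ∞`, against the decay. (Proof device.) [folklore] -/
private theorem eq_zero_of_convect_self_eq_zero_of_decay {E : Type*} [NormedAddCommGroup E]
    [NormedSpace ℝ E] {U : E → E} (hU : ContDiff ℝ 1 U)
    (hdec : ∃ C : ℝ, ∀ y, (1 + ‖y‖) * ‖U y‖ ≤ C) (h : ∀ x, fderiv ℝ U x (U x) = 0) : U = 0 := by
  obtain ⟨C, hC⟩ := hdec
  have hdiff : Differentiable ℝ U := hU.differentiable one_ne_zero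
  have hcontD : Continuous (fderiv ℝ U) := hU.continuous_fderiv one_ne_zero
  funext x₀
  by_contra hx₀
  simp only [Pi.zero_apply] at hx₀
  set v : E := U x₀ with hv
  have hvpos : 0 < ‖v‖ := norm_pos_iff.2 hx₀
  -- the defect along the straight line
  set w : ℝ → E := fun t => U (x₀ + t • v) - v with hw
  have hline : ∀ t, HasDerivAt (fun t : ℝ => x₀ + t • v) v t := fun t => by
    simpa using ((hasDerivAt_id t).smul_const v).const_add x₀
  have hderiv : ∀ t, HasDerivAt w (fderiv ℝ U (x₀ + t • v) v) t := fun t => by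
    have h1 : HasDerivAt (fun t : ℝ => U (x₀ + t • v)) (fderiv ℝ U (x₀ + t • v) v) t :=
      ((hdiff (x₀ + t • v)).hasFDerivAt.comp_hasDerivAt t (hline t))
    simpa [hw] using h1.sub_const v
  -- the linear ODE `w' = -DU w`
  have hkey : ∀ t, fderiv ℝ U (x₀ + t • v) v = -(fderiv ℝ U (x₀ + t • v) (w t)) := fun t => by
    simp only [hw, map_sub, h (x₀ + t • v), zero_sub, neg_neg]
  have hzero : ∀ b : ℝ, 0 ≤ b → w b = 0 := fun b hb => by
    -- a bound on `DU` along the segment `[0,b]`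
    obtain ⟨K, hK⟩ : ∃ K : ℝ, ∀ t ∈ Icc (0 : ℝ) b, ‖fderiv ℝ U (x₀ + t • v)‖ ≤ K := by
      have hc : Continuous fun t : ℝ => fderiv ℝ U (x₀ + t • v) :=
        hcontD.comp (continuous_const.add (continuous_id.smul continuous_const))
      exact isCompact_Icc.exists_bound_of_continuousOn hc.continuousOn
    exact eq_zero_of_abs_deriv_le_mul_abs_self_of_eq_zero_right (K := K)
      (fun t _ => (hderiv t).continuousAt.continuousWithinAt)
      (fun t _ => (hderiv t).hasDerivWithinAt)
      (by simp [hw, hv])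
      (fun t ht => by
        rw [hkey t, norm_neg]
        exact (ContinuousLinearMap.le_opNorm _ _).trans
          (mul_le_mul_of_nonneg_right (hK t (Ico_subset_Icc_self ht)) (norm_nonneg _)))
      b ⟨hb, le_rfl⟩
  -- far out along the line the decay bound fails: the field still equals `v ≠ 0` there
  have hCx₀ : (1 + ‖x₀‖) * ‖v‖ ≤ C := hC x₀
  have hCpos : 0 < C := lt_of_lt_of_le (by positivity) hCx₀
  set t₁ : ℝ := (C / ‖v‖ + ‖x₀‖) / ‖v‖ with ht₁
  have ht₁pos : 0 ≤ t₁ := by rw [ht₁]; positivity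
  have hUy : U (x₀ + t₁ • v) = v := by
    have := hzero t₁ ht₁pos
    rwa [hw, sub_eq_zero] at this
  have hy : C / ‖v‖ ≤ ‖x₀ + t₁ • v‖ := by
    have h2 : t₁ * ‖v‖ - ‖x₀‖ ≤ ‖x₀ + t₁ • v‖ := by
      have := norm_sub_norm_le (t₁ • v) (-x₀)
      rw [norm_smul, Real.norm_eq_abs, abs_of_nonneg ht₁pos, norm_neg, sub_neg_eq_add,
        add_comm] at this
      linarith
    have h3 : t₁ * ‖v‖ = C / ‖v‖ + ‖x₀‖ := by rw [ht₁, div_mul_cancel₀ _ hvpos.ne']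
    linarith
  have h4 := hC (x₀ + t₁ • v)
  rw [hUy] at h4
  have h5 : (1 + C / ‖v‖) * ‖v‖ ≤ C :=
    (mul_le_mul_of_nonneg_right (by linarith) hvpos.le).trans h4
  rw [add_mul, one_mul, div_mul_cancel₀ _ hvpos.ne'] at h5
  linarith

/-- **The (11)-data class is the zero datum**: a smooth, divergence-free, rapidly decreasing (Clay (4))
field `v₀` on `ℝ³` with `(v₀,∇)v₀ = 0` ((11) p.7) is `0`, and `0` is such a field. (Proof device.)
[cite: Baev2022ru, (10)–(11) p.7; p.10; p.14] -/
private theorem isDatum_cond11_iff (v₀ : E3 → E3) : IsDatum v₀ ∧ Cond11 v₀ ↔ v₀ = 0 := by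
  constructor
  · rintro ⟨⟨hsmooth, -, hdecay⟩, h11⟩
    refine eq_zero_of_convect_self_eq_zero_of_decay (hsmooth.of_le (mod_cast le_top)) ?_
      (fun x => h11 x)
    obtain ⟨C, hC⟩ := hdecay 0 1
    exact ⟨C, fun y => by simpa [norm_iteratedFDeriv_zero] using hC y⟩
  · rintro rfl
    refine ⟨⟨contDiff_const, fun x => ?_, fun n K => ⟨0, fun x => ?_⟩⟩, fun x => ?_⟩
    · have h1 : (0 : E3 → E3) = fun _ => (0 : E3) := rfl
      rw [NSWave0.divergence, h1, fderiv_const_apply]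
      simp
    · simp
    · simp [convect]

/-- **The (11)-reading of the claimed theorem is a THEOREM — for the zero datum, the only one in its
class**: `ClaimedTheorem11` holds, witnessed by the rest state `v ≡ 0` with pressure `0`
(`Literature.Analysis.FluidPDE.isNavierStokesSolution_zero`); by `isDatum_cond11_iff` no other datum is
covered, so the sentence carries no information about Clay (A). Literature-side twin of the Summits-side
`Summit.NavierStokesRegularity.NavierStokesRegularity.Theorems.Baev2022.claimedTheorem11_holds`.
[cite: Baev2022ru, Теорема 3 p.15 with (11) p.7, p.14] -/
theorem claimedTheorem11_holds : ClaimedTheorem11 := by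
  intro ε _ v₀ hd h11
  obtain rfl : v₀ = 0 := (isDatum_cond11_iff v₀).1 ⟨hd, h11⟩
  obtain ⟨h1, h2, -⟩ := isNavierStokesSolution_zero (E := E3) ε
  refine ⟨0, ⟨h2, h1⟩, fun M hM t _ x => ?_, fun t _ => le_rfl⟩
  simpa using hM x

end Cond11Certificate

end Literature.Claims.NS.Baev2022

end

-- WHAT THIS IS NOT: not a claim about NS regularity or blow-up; not a claim about any author beyond the
-- typed locator.
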